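import Mathlib.Dynamics.Flow
import Mathlib.Topology.Instances.NNReal.Lemmas
import Mathlib.Topology.Order.Basic
import HarnessLib

/-!
# Semiflows, solutions, Conley's exit sets `W⁰`, `W⁻` and Ważewski sets

Topic `Literature/Dynamics/ConleyIndex` (definition item `defn-IsIsolatingBlock`, wanted by route
`AnomalousDissipation/WazewskiBlock`, item `WazewskiRetract`); companion file
`IsolatingBlock.lean` (Rybakowski's strict egress / ingress / bounce-off points and isolating
blocks).  Mathlib has continuous monoid actions (`Flow τ α`; `Flow ℝ≥0 X` = a continuous global
semiflow) and (forward) invariant sets, but none of the vocabulary of Ważewski's retract method /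
Conley's index theory.  This file supplies DEFINITIONS and their elementary API only; Ważewski's
theorem itself [Conley1976, Thm. 1.3; Wazewski1947] is to be PROVED in a companion file, not
stated as a fact.

## Conventions (chosen to match the consumers literally)

A (global, continuous) **semiflow** is an unbundled map `φ : ℝ → X → X` on a topological space
together with the hypothesis structure `IsSemiflow φ`: `φ 0 = id`, `φ (s + t) = φ s ∘ φ t` for
`s, t ≥ 0`, and joint continuity on `[0, ∞) × X` (values of `φ t` for `t < 0` are junk and never
used) — exactly the binders of the route item
`Summit.AnomalousDissipation.AnomalousDissipation.Theses.WazewskiBlock.WazewskiRetract`;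
`IsSemiflow.toFlow` / `IsSemiflow.of_flow` translate to and from Mathlib's bundled `Flow ℝ≥0 X`.
The SETS below are defined for a bare `φ` (no hypotheses, no topology), so that they unfold by
`rfl` (`immediateExitSet_eq` is literally the route item's inline set).

## Contents

* `eventualExitSet φ W` = `W⁰ := {x ∈ W | ∃ t > 0, φ t x ∉ W}` and
  `immediateExitSet φ W` = `W⁻ := {x ∈ W | ∀ δ > 0, ∃ t ∈ (0, δ), φ t x ∉ W}` — Conley's points
  which "eventually (resp. immediately) leave `W`" [Conley1976, §1, Def. 1.2, p. 62] (Conley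
  writes `∃ t ∈ ℝ⁺, x·t ∉ W`, resp. `∀ ε > 0, x·[0, ε] ⊄ W`; the same sets because `x·0 = x ∈ W`).
* `IsSolutionOn φ σ J` — a solution `σ` of the semiflow on the set of times `J`
  (`σ (t + s) = φ s (σ t)`), after [HaleMagalhaesOliva2002, App. A (by K. P. Rybakowski), p. 242];
  needed by `IsolatingBlock.lean` because backward continuations of a semiflow are neither unique
  nor existent in general.
* `IsSemiflow φ` and its API (continuity of orbits and time maps, `toFlow`, `of_flow`,
  `isSolutionOn_orbit`, `immediateExitSet_subset_frontier`).
* `IsWazewskiSet φ W` — Conley's two conditions: (a) `x ∈ W`, `x·[0,t] ⊆ cl W ⇒ x·[0,t] ⊆ W`;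
  (b) `W⁻` is closed relative to `W⁰` [Conley1976, §1, Def. 1.2, p. 62].  For CLOSED `W`, (a) is
  automatic and the notion is "`cl(W⁻) ∩ W⁰ ⊆ W⁻`" (`isWazewskiSet_iff_of_isClosed`).
  Ważewski's theorem [Conley1976, Thm. 1.3]: for a Ważewski set, `W⁻` is a strong deformation
  retract of `W⁰` and `W⁰` is open in `W` (not here).
-/

open Set Filter
open scoped Topology NNReal

namespace Literature.Dynamics.ConleyIndex

variable {X : Type*}

/-! ### Conley's exit sets `W⁰`, `W⁻`; solutions (no topology needed) -/

/-- **`W⁰`, the points of `W` which eventually leave `W`** (in forward time):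
`{x ∈ W | ∃ t > 0, φ t x ∉ W}`.  Conley writes `t ∈ ℝ⁺`; as `φ 0 x = x ∈ W` this is the same.
[cite: Conley1976, §1, Def. 1.2, p. 62] -/
def eventualExitSet (φ : ℝ → X → X) (W : Set X) : Set X :=
  {x : X | x ∈ W ∧ ∃ t : ℝ, 0 < t ∧ φ t x ∉ W}

/-- **`W⁻`, the points of `W` which immediately leave `W`**: `{x ∈ W | ∀ δ > 0, ∃ t ∈ (0, δ),
φ t x ∉ W}` (Conley: "`∀ ε > 0`, `x·[0, ε] ⊄ W`"; the same set since `x·0 = x ∈ W`).  Written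
with exactly the binders of the route item `…WazewskiBlock.WazewskiRetract`, so that it unfolds to
that item's inline set by `rfl` (`immediateExitSet_eq`). [cite: Conley1976, §1, Def. 1.2, p. 62] -/
def immediateExitSet (φ : ℝ → X → X) (W : Set X) : Set X :=
  {x : X | x ∈ W ∧ ∀ δ : ℝ, 0 < δ → ∃ t ∈ Set.Ioo 0 δ, φ t x ∉ W}

/-- `σ : ℝ → X` is a **solution** of the semiflow `φ` on the set of times `J ⊆ ℝ`: for all
`t ∈ J` and `s ≥ 0` with `t + s ∈ J`, `σ (t + s) = φ s (σ t)` (values of `σ` off `J` are junk).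
Forward in time a solution through `x = σ 0` is the orbit `t ↦ φ t x`; backward it need be
neither unique nor extendable. [cite: HaleMagalhaesOliva2002, App. A, p. 242] -/
def IsSolutionOn (φ : ℝ → X → X) (σ : ℝ → X) (J : Set ℝ) : Prop :=
  ∀ ⦃t : ℝ⦄, t ∈ J → ∀ ⦃s : ℝ⦄, 0 ≤ s → t + s ∈ J → σ (t + s) = φ s (σ t)

section NoTopology

variable (φ : ℝ → X → X) (W : Set X)

/-- `immediateExitSet` is literally the inline set of the route item `WazewskiRetract`. [folklore] -/
theorem immediateExitSet_eq : immediateExitSet φ W =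
    {x : X | x ∈ W ∧ ∀ δ : ℝ, 0 < δ → ∃ t ∈ Set.Ioo 0 δ, φ t x ∉ W} := rfl

variable {φ W}

/-- Membership in `W⁰`. [folklore] -/
@[simp] theorem mem_eventualExitSet_iff {x : X} :
    x ∈ eventualExitSet φ W ↔ x ∈ W ∧ ∃ t : ℝ, 0 < t ∧ φ t x ∉ W := Iff.rfl

/-- Membership in `W⁻`. [folklore] -/
@[simp] theorem mem_immediateExitSet_iff {x : X} :
    x ∈ immediateExitSet φ W ↔ x ∈ W ∧ ∀ δ : ℝ, 0 < δ → ∃ t ∈ Set.Ioo 0 δ, φ t x ∉ W := Iff.rfl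

/-- `W⁰ ⊆ W`. [folklore] -/
theorem eventualExitSet_subset : eventualExitSet φ W ⊆ W := fun _ hx => hx.1

/-- `W⁻ ⊆ W`. [folklore] -/
theorem immediateExitSet_subset : immediateExitSet φ W ⊆ W := fun _ hx => hx.1

/-- `W⁻ ⊆ W⁰`: a point which leaves immediately leaves eventually. [folklore] -/
theorem immediateExitSet_subset_eventualExitSet : immediateExitSet φ W ⊆ eventualExitSet φ W := by
  rintro x ⟨hxW, hx⟩
  obtain ⟨t, ht, hout⟩ := hx 1 one_pos
  exact ⟨hxW, t, ht.1, hout⟩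

/-- A solution is, forward in time, the orbit of its initial point: if `σ` solves on `J ∋ 0`
then `σ t = φ t (σ 0)` for every `t ≥ 0` in `J`. [folklore] -/
theorem IsSolutionOn.eq_orbit {σ : ℝ → X} {J : Set ℝ}
    (hσ : IsSolutionOn φ σ J) (h0 : (0 : ℝ) ∈ J) {t : ℝ} (ht : 0 ≤ t) (htJ : t ∈ J) :
    σ t = φ t (σ 0) := by
  have := hσ h0 ht (by simpa using htJ)
  simpa using this

/-- Restricting the set of times preserves solutions. [folklore] -/
theorem IsSolutionOn.mono {σ : ℝ → X} {J J' : Set ℝ} (hσ : IsSolutionOn φ σ J) (h : J' ⊆ J) :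
    IsSolutionOn φ σ J' :=
  fun _ ht _ hs hts => hσ (h ht) hs (h hts)

end NoTopology

variable [TopologicalSpace X]

/-! ### Semiflows (unbundled) -/

/-- `IsSemiflow φ`: the unbundled map `φ : ℝ → X → X` is a continuous (global) **semiflow** —
`φ 0 = id`, `φ (s + t) = φ s ∘ φ t` for `s, t ≥ 0`, and `(t, x) ↦ φ t x` is continuous on
`[0, ∞) × X` (the values `φ t`, `t < 0`, are never used).  A (global) semiflow in the sense of
[HaleMagalhaesOliva2002, App. A, Def. A.0.1 and Rem. A.0.2] (`ω_x = ∞`); the binder shape is that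
of the route item `…Theses.WazewskiBlock.WazewskiRetract`. [cite: HaleMagalhaesOliva2002, App. A, Def. A.0.1, p. 242] -/
structure IsSemiflow (φ : ℝ → X → X) : Prop where
  /-- joint continuity on `[0, ∞) × X` -/
  continuousOn : ContinuousOn (fun p : ℝ × X => φ p.1 p.2) (Ici 0 ×ˢ univ)
  /-- `φ 0 = id` -/
  map_zero : ∀ x, φ 0 x = x
  /-- the semigroup law for nonnegative times -/
  map_add : ∀ s t : ℝ, 0 ≤ s → 0 ≤ t → ∀ x, φ (s + t) x = φ s (φ t x)

namespace IsSemiflow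

variable {φ : ℝ → X → X} {W : Set X}

/-- The forward motion `t ↦ φ t x` of a point is continuous on `[0, ∞)`. [folklore] -/
theorem continuousOn_orbit (hφ : IsSemiflow φ) (x : X) : ContinuousOn (fun t => φ t x) (Ici 0) :=
  hφ.continuousOn.comp (f := fun t : ℝ => (t, x)) (Continuous.prodMk_left x).continuousOn
    fun _ ht => ⟨ht, mem_univ _⟩

/-- The forward motion of a point is continuous from the right at every `t ≥ 0`. [folklore] -/
theorem continuousWithinAt_orbit (hφ : IsSemiflow φ) (x : X) {t : ℝ} (ht : 0 ≤ t) :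
    ContinuousWithinAt (fun s => φ s x) (Ici 0) t :=
  hφ.continuousOn_orbit x t ht

/-- Each time-`t` map `φ t`, `t ≥ 0`, is continuous. [folklore] -/
theorem continuous_apply (hφ : IsSemiflow φ) {t : ℝ} (ht : 0 ≤ t) : Continuous (φ t) :=
  (hφ.continuousOn.comp_continuous (f := fun x : X => (t, x)) (Continuous.prodMk_right t)
    fun _ => ⟨ht, mem_univ _⟩ :)

/-- `(t, x) ↦ φ t x` is jointly continuous at every point of `[0, ∞) × X` within `[0, ∞) × X`.
[folklore] -/
theorem continuousWithinAt (hφ : IsSemiflow φ) {t : ℝ} (ht : 0 ≤ t) (x : X) :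
    ContinuousWithinAt (fun p : ℝ × X => φ p.1 p.2) (Ici 0 ×ˢ univ) (t, x) :=
  hφ.continuousOn (t, x) ⟨ht, mem_univ _⟩

/-- The semigroup law with the factors swapped: `φ (s + t) = φ t ∘ φ s` for `s, t ≥ 0`
(the time-`s` and time-`t` maps of a semiflow commute). [folklore] -/
theorem map_add' (hφ : IsSemiflow φ) {s t : ℝ} (hs : 0 ≤ s) (ht : 0 ≤ t) (x : X) :
    φ (s + t) x = φ t (φ s x) := by
  rw [add_comm, hφ.map_add t s ht hs]

/-- An unbundled semiflow is the same thing as Mathlib's bundled continuous monoid action of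
`ℝ≥0`: the `Flow ℝ≥0 X` attached to `IsSemiflow φ`. [folklore] -/
noncomputable def toFlow (hφ : IsSemiflow φ) : Flow ℝ≥0 X where
  toFun t x := φ t x
  cont' := by
    have h : Continuous fun p : ℝ≥0 × X => ((p.1 : ℝ), p.2) :=
      (NNReal.continuous_coe.comp continuous_fst).prodMk continuous_snd
    exact hφ.continuousOn.comp_continuous h fun p => ⟨p.1.2, mem_univ _⟩
  map_add' s t x := by
    simp only [NNReal.coe_add]
    exact hφ.map_add _ _ s.2 t.2 x
  map_zero' x := by simpa using hφ.map_zero x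

/-- `toFlow` has the same time maps as `φ` on `ℝ≥0`. [folklore] -/
@[simp] theorem toFlow_apply (hφ : IsSemiflow φ) (t : ℝ≥0) (x : X) : hφ.toFlow t x = φ t x := rfl

/-- Conversely, a bundled `Flow ℝ≥0 X`, extended by junk (`Real.toNNReal`) to negative times, is
an unbundled semiflow. [folklore] -/
theorem of_flow (ψ : Flow ℝ≥0 X) : IsSemiflow fun t x => ψ (Real.toNNReal t) x where
  continuousOn := by
    have h : Continuous fun p : ℝ × X => ψ (Real.toNNReal p.1) p.2 :=
      ψ.continuous (continuous_real_toNNReal.comp continuous_fst) continuous_snd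
    exact h.continuousOn
  map_zero x := by simp [Flow.map_zero_apply]
  map_add s t hs ht x := by
    rw [Real.toNNReal_add hs ht, Flow.map_add]


/-- The forward orbit `t ↦ φ t x` is a solution on `[0, δ]` (indeed on `[0, ∞)`). [folklore] -/
theorem isSolutionOn_orbit (hφ : IsSemiflow φ) (x : X) (J : Set ℝ) (hJ : J ⊆ Ici 0) :
    IsSolutionOn φ (fun t => φ t x) J := by
  intro t ht s hs _
  simp only
  rw [add_comm, hφ.map_add s t hs (hJ ht)]

/-- For a semiflow, a point of `W` which immediately leaves `W` is a boundary point: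
`immediateExitSet φ W ⊆ ∂B` (an interior point stays in the open set `int W` for a while, by
continuity of its motion). [folklore] -/
theorem immediateExitSet_subset_frontier (hφ : IsSemiflow φ) :
    immediateExitSet φ W ⊆ frontier W := by
  rintro x ⟨hxW, hx⟩
  change x ∈ closure W ∧ x ∉ interior W
  refine ⟨subset_closure hxW, fun hxint => ?_⟩
  -- the motion of `x` stays in `interior W` for small `t ≥ 0`
  have hcont := hφ.continuousWithinAt_orbit x le_rfl
  have hnhds : interior W ∈ 𝓝 (φ 0 x) := by
    rw [hφ.map_zero]; exact isOpen_interior.mem_nhds hxint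
  have hev : ∀ᶠ t in 𝓝[Ici (0 : ℝ)] 0, φ t x ∈ interior W := hcont hnhds
  rw [nhdsWithin, Filter.eventually_inf_principal, Metric.eventually_nhds_iff] at hev
  obtain ⟨δ, hδ, hstay⟩ := hev
  obtain ⟨t, ht, hout⟩ := hx δ hδ
  refine hout (interior_subset (hstay ?_ ht.1.le))
  rw [Real.dist_eq, sub_zero, abs_of_pos ht.1]
  exact ht.2

end IsSemiflow

/-! ### Ważewski sets -/

/-- **Ważewski set** (Conley's formulation, for a (semi)flow `φ` on a topological space):
`W ⊆ X` is a Ważewski set if (a) whenever `x ∈ W` and the orbit segment `x·[0, t]` lies in the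
closure of `W`, it lies in `W`; and (b) `W⁻` is closed relative to `W⁰` (there is a closed `C` with
`C ∩ W⁰ = W⁻`).  Ważewski's theorem [Conley1976, Thm. 1.3]: then `W⁻` is a strong deformation
retract of `W⁰` and `W⁰` is open in `W`. [cite: Conley1976, §1, Def. 1.2, p. 62] -/
def IsWazewskiSet (φ : ℝ → X → X) (W : Set X) : Prop :=
  (∀ x ∈ W, ∀ t : ℝ, 0 ≤ t → (∀ s ∈ Icc 0 t, φ s x ∈ closure W) → ∀ s ∈ Icc 0 t, φ s x ∈ W) ∧
    ∃ C : Set X, IsClosed C ∧ C ∩ eventualExitSet φ W = immediateExitSet φ W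

/-- Unfolding `IsWazewskiSet`. [folklore] -/
theorem isWazewskiSet_iff {φ : ℝ → X → X} {W : Set X} : IsWazewskiSet φ W ↔
    (∀ x ∈ W, ∀ t : ℝ, 0 ≤ t → (∀ s ∈ Icc 0 t, φ s x ∈ closure W) → ∀ s ∈ Icc 0 t, φ s x ∈ W) ∧
      ∃ C : Set X, IsClosed C ∧ C ∩ eventualExitSet φ W = immediateExitSet φ W := Iff.rfl

namespace IsWazewskiSet

variable {φ : ℝ → X → X} {W : Set X}

/-- Condition (b) in closure form: `cl(W⁻) ∩ W⁰ ⊆ W⁻`. [folklore] -/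
theorem closure_inter_subset (h : IsWazewskiSet φ W) :
    closure (immediateExitSet φ W) ∩ eventualExitSet φ W ⊆ immediateExitSet φ W := by
  obtain ⟨C, hC, hCW⟩ := h.2
  rintro x ⟨hxcl, hx0⟩
  rw [← hCW]
  refine ⟨?_, hx0⟩
  have : immediateExitSet φ W ⊆ C := fun y hy => (hCW.symm.subset hy).1
  exact hC.closure_subset_iff.2 this hxcl

/-- Condition (a): orbit segments in `cl W` starting in `W` stay in `W`. [folklore] -/
theorem mem_of_orbit_subset_closure (h : IsWazewskiSet φ W) {x : X} (hx : x ∈ W) {t : ℝ}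
    (ht : 0 ≤ t) (hcl : ∀ s ∈ Icc 0 t, φ s x ∈ closure W) : ∀ s ∈ Icc 0 t, φ s x ∈ W :=
  h.1 x hx t ht hcl

/-- **Constructor for closed sets.**  A closed `W` is a Ważewski set as soon as
`cl(W⁻) ∩ W⁰ ⊆ W⁻` (condition (a) is automatic since `cl W = W`). [folklore] -/
theorem of_isClosed (hW : IsClosed W)
    (h : closure (immediateExitSet φ W) ∩ eventualExitSet φ W ⊆ immediateExitSet φ W) :
    IsWazewskiSet φ W := by
  refine ⟨fun x _ t _ hcl s hs => ?_, ⟨closure (immediateExitSet φ W), isClosed_closure, ?_⟩⟩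
  · simpa [hW.closure_eq] using hcl s hs
  · refine Subset.antisymm h fun x hx => ⟨subset_closure hx, ?_⟩
    exact immediateExitSet_subset_eventualExitSet hx

end IsWazewskiSet

/-- For a CLOSED set, `IsWazewskiSet φ W` is exactly "`W⁻` is closed relative to `W⁰`"
(in closure form). [folklore] -/
theorem isWazewskiSet_iff_of_isClosed {φ : ℝ → X → X} {W : Set X} (hW : IsClosed W) :
    IsWazewskiSet φ W ↔
      closure (immediateExitSet φ W) ∩ eventualExitSet φ W ⊆ immediateExitSet φ W :=
  ⟨IsWazewskiSet.closure_inter_subset, IsWazewskiSet.of_isClosed hW⟩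

end Literature.Dynamics.ConleyIndex
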